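import Mathlib
import HarnessLib
import Literature.NumberTheory.Automorphic.BaseChangeCyclicCuspidalProofs
import Literature.NumberTheory.Automorphic.ArthurClozelBaseChange

/-!
# Stub `stub_clauseA_of_weakLiftingGL2` of line Sketch (crux stmt-Langlands-16812
`ParityBlindBianchi.QuadraticBaseChangeGL2`) — clause (a) from Thm. 4.2 (a) in `L²` at rank `2`

Helper file (`--supports stmt-Langlands-16812`) of the quadratic base change theorem for `GL₂`
(crux `QuadraticBaseChangeGL2`, proved BY NAME from seven registered stubs).  This file lands the
PROVABLE reduction `stub_clauseA_of_weakLiftingGL2`: clause (a) of the crux — for `E/F` Galois with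
`[E:F] = 2` and a cuspidal Borel–Jacquet datum `π` on `GL₂(𝔸_F)` carrying, at some inert place `v`,
a Satake parameter `α` not fixed by `-1` (the non-twist witness "`π ≇ π ⊗ η_{E/F}`" read off at one
inert place), there is a CUSPIDAL Borel–Jacquet datum `Π` on `GL₂(𝔸_E)` with
`t_{Π,w} = t_{π,v}^{f(w|v)}` for almost all `w` (`IsWeakBaseChangeLiftAE`) — from

* `hX` : Arthur–Clozel 1989, Ch. 3, Thm. 4.2 (a) in the `L²` model at rank `2` for quadratic
  extensions (`ArthurClozel1989_weakLifting_cuspidal 2 F E`, produced on the line by the neighbour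
  `stub_weakLiftingGL2_of_liftDatum`), and
* `hm1` : multiplicity one on `L²_cusp(GL₂(𝔸_K))` (`multiplicity_one_gl 2 K μ`),

both HYPOTHESES of the stub.  The proof is the `n = 2` copy of the tree theorem
`baseChange_cyclic_cuspidal_of_weakLifting` (`Literature/NumberTheory/Automorphic/
BaseChangeCyclicCuspidalProofs.lean`), which applies `hX` exactly once, at `(n, F, E)`, and `hm1`
exactly once, at `(n, F, μ)`: clean model with the same Satake parameters
(`CuspidalAutomorphicRepData.exists_clean_hasSatakeParamAt_iff_of_sSup_irreducible` with the proved
`AutomorphicRepsGL.stable_cuspidal_eq_sSup_irreducible_holds`), its `L²` normalisation `P` with the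
dictionary Borel–Jacquet `→ L²` at every place
(`CuspidalAutomorphicRepData.exists_hasSatakeParameterAt_cpow_mul_of_clean`), `P ⊗ η ≠ P`
(`CuspidalAutomorphicRepGL.twistByFiniteOrderChar_ne_of_hasSatakeParameterAt`), the cuspidal weak
lift `Q ≤ L²_cusp` over `E` from `hX` (fed with `hm1`), its Borel–Jacquet realisation `ρ`
(`CuspidalAutomorphicRepGL.exists_cuspidalRepData_hasSatakeParamAt`) and the `|det|_E^{s}` twist
`Π = ρ ⊗ |det|^{s}` (`exists_cuspidalAutomorphicRepData_map_mulChar_detTwist`), compared through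
`IsWeakBaseChangeLift.eventually_map_pow_eq` and `HasSatakeParameterAt.eq_of_ofLocal_eq_smul`
(`Flath1979_heckeOperatorAt_ofLocal_eq_smul_holds`).

No definitions, no named facts.
-/

noncomputable section

open scoped BigOperators Topology Classical Matrix NumberField MatrixGroups Polynomial
open Literature.NumberTheory.Automorphic Literature.NumberTheory.GaloisRepresentations
  IsDedekindDomain NumberField Field Polynomial Filter MeasureTheory
open Literature.NumberTheory.Automorphic.AdelicGroupData

-- `Summit.Langlands.Langlands.…`: summit = sub-problem name (D-0017 nested layout), not a typo.
set_option linter.dupNamespace false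

namespace Summit.Langlands.Langlands.Theorems.QuadraticBaseChangeGL2

/-! ### The stub -/

/-- **Stub `stub_clauseA_of_weakLiftingGL2` (clause (a) of quadratic base change for `GL₂` from
Arthur–Clozel's Thm. 4.2 (a) in `L²` at rank `2` and multiplicity one on `GL₂`).**  Granting, for
all quadratic extensions `E/F` of number fields, the `L²` rendering
`ArthurClozel1989_weakLifting_cuspidal 2 F E` of Thm. 4.2 (a) (`hX`) and multiplicity one on
`L²_cusp(GL₂)` over every number field (`hm1`): for `E/F` Galois with `[E:F] = 2` and `π` a cuspidal
Borel–Jacquet datum on `GL₂(𝔸_F)` with, at some inert `v` (a place `w ∣ v` of residue degree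
`2 = [E:F]`), a Satake parameter `α` with `ζ • α ≠ α` for every primitive square root of unity `ζ`,
there is a **cuspidal** datum `Π` on `GL₂(𝔸_E)` with `t_{Π,w} = (t_{π,v})^{f(w|v)}` for almost all
`w` (Def. 1.1, `IsWeakBaseChangeLiftAE`).  The `n = 2` copy of
`baseChange_cyclic_cuspidal_of_weakLifting`: `v` is unramified with `f_v = 2`
(`ramificationIdxIn_eq_one_of_inertiaDeg_eq_finrank`); a clean model `π₀` with the same Satake
parameters (`exists_clean_hasSatakeParamAt_iff_of_sSup_irreducible`,
`AutomorphicRepsGL.stable_cuspidal_eq_sSup_irreducible_holds`) is normalised into `P ≤ L²_cusp` with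
`t_{π,v} ↦ q_v^{-s} t_{π,v}` at every place (`exists_hasSatakeParameterAt_cpow_mul_of_clean`);
`P ⊗ η ≠ P` (`twistByFiniteOrderChar_ne_of_hasSatakeParameterAt`); `hX` (fed with `hm1`) gives a
cuspidal weak lift `Q ≤ L²_cusp` over `E`, realised a.e. by a cuspidal datum `ρ`
(`CuspidalAutomorphicRepGL.exists_cuspidalRepData_hasSatakeParamAt`), and `Π = ρ ⊗ |det|_E^{s}`
(`exists_cuspidalAutomorphicRepData_map_mulChar_detTwist`) has
`t_{Π,w} = q_w^{s} t_{Q,w} = q_w^{s} (t_{P,v})^{f} = (q_v^{s} t_{P,v})^{f} = (t_{π,v})^{f}` a.e.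
(`IsWeakBaseChangeLift.eventually_map_pow_eq`, `HasSatakeParameterAt.eq_of_ofLocal_eq_smul` with
`Flath1979_heckeOperatorAt_ofLocal_eq_smul_holds`, `q_w = q_v^{f}`).
[cite: ArthurClozelAMS120, Ch. 3, Thm. 4.2 (a)] -/
theorem stub_clauseA_of_weakLiftingGL2
    (hX : ∀ (F E : Type) [Field F] [NumberField F] [Field E] [NumberField E] [Algebra F E]
      [FiniteDimensional F E], Module.finrank F E = 2 → ArthurClozel1989_weakLifting_cuspidal 2 F E)
    (hm1 : ∀ (K : Type) [Field K] [NumberField K] (μ : Measure (gl 2 K).automorphicQuotient)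
      [(gl 2 K).IsAutomorphicMeasure μ], multiplicity_one_gl 2 K μ) :
    ∀ (F E : Type) [Field F] [NumberField F] [Field E] [NumberField E] [Algebra F E] [IsGalois F E], Module.finrank F E = 2 → ∀ (hF : Literature.NumberTheory.Automorphic.isCompact_glFiniteIntegralLevel 2 F) (π : Literature.NumberTheory.Automorphic.CuspidalAutomorphicRepData 2 F hF), (∃ (v : IsDedekindDomain.HeightOneSpectrum (NumberField.RingOfIntegers F)) (w : IsDedekindDomain.HeightOneSpectrum (NumberField.RingOfIntegers E)) (α : Multiset ℂ), w.asIdeal.under (NumberField.RingOfIntegers F) = v.asIdeal ∧ w.asIdeal.inertiaDeg (NumberField.RingOfIntegers F) = Module.finrank F E ∧ π.1.HasSatakeParamAt v α ∧ ∀ ζ : ℂ, IsPrimitiveRoot ζ (Module.finrank F E) → α.map (ζ * ·) ≠ α) → ∀ (hE : Literature.NumberTheory.Automorphic.isCompact_glFiniteIntegralLevel 2 E), ∃ P : Literature.NumberTheory.Automorphic.CuspidalAutomorphicRepData 2 E hE, Literature.NumberTheory.Automorphic.IsWeakBaseChangeLiftAE π.1 P.1 := by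
  -- adapted from Literature/NumberTheory/Automorphic/BaseChangeCyclicCuspidalProofs.lean (baseChange_cyclic_cuspidal_of_weakLifting)
  intro F E _ _ _ _ _ _ h2 hF π hH hE
  classical
  obtain ⟨v, w₀, α, hvw, hfw, hα, hne⟩ := hH
  have hℓ : (Module.finrank F E).Prime := h2 ▸ Nat.prime_two
  haveI : FiniteDimensional F E := Module.finite_of_finrank_eq_succ h2
  haveI : Fact (Module.finrank F E).Prime := ⟨hℓ⟩
  haveI : IsCyclic (E ≃ₐ[F] E) := isCyclic_of_prime_card (IsGalois.card_aut_eq_finrank F E)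
  -- `v` is unramified in `E`, of residue degree `2`
  obtain ⟨he, hfIn⟩ := ramificationIdxIn_eq_one_of_inertiaDeg_eq_finrank hvw hfw
  -- the automorphic measure over `F` and the class-field character `η`
  obtain ⟨μ, hμA⟩ := AdelicGroupData.exists_isAutomorphicMeasure_gl_holds 2 F
  haveI := hμA
  obtain ⟨η, hη, -⟩ := exists_isClassFieldCharacter_holds (F := F) (E := E)
  -- clean model with the same Satake parameters, and its `L²` normalisation `P`
  obtain ⟨π₀, h0W', h0π⟩ := π.exists_clean_hasSatakeParamAt_iff_of_sSup_irreducible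
    AutomorphicRepsGL.stable_cuspidal_eq_sSup_irreducible_holds
  obtain ⟨s, P, hpt⟩ := CuspidalAutomorphicRepData.exists_hasSatakeParameterAt_cpow_mul_of_clean
    (μ := μ) π π₀ h0W' fun v β h => (h0π v β).2 h
  -- `P ⊗ η ≠ P`
  have hPη : P.twistByFiniteOrderChar η hη.isFiniteOrder ≠ P :=
    CuspidalAutomorphicRepGL.twistByFiniteOrderChar_ne_of_hasSatakeParameterAt hℓ hη π P hpt he hfIn
      hα hne
  -- Thm. 4.2 (a) in `L²` at rank `2`: a cuspidal weak lift `Q` over `E`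
  obtain ⟨ν, hνA, hνG, Q, hlift, -, -⟩ := hX F E h2 two_pos hℓ η hη μ (hm1 F μ) P hPη
  haveI := hνA
  -- `E` side: a cuspidal datum `ρ` with the Satake parameters of `Q` a.e., and `Π = ρ ⊗ |det|_E^{s}`
  obtain ⟨ρ, -, hρ⟩ := Q.exists_cuspidalRepData_hasSatakeParamAt hE
  obtain ⟨S, αP, -, hαP⟩ := exists_isSatakeFamilyOf_holds (n := 2) (K := F) (μ := μ) P
  obtain ⟨S₁, AQ, -, hAQ⟩ := exists_isSatakeFamilyOf_holds (n := 2) (K := E) (μ := ν) Q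
  obtain ⟨χ, hχ⟩ := exists_heckeCharacter_ideleNorm_cpow E (-s)
  obtain ⟨PE, hPEW, hPEW'⟩ := exists_cuspidalAutomorphicRepData_map_mulChar_detTwist hχ ρ
  refine ⟨PE, ?_⟩
  -- relation (1.1) between the families `αP` of `P` and `AQ` of `Q`, almost everywhere
  have hrel := hlift.eventually_map_pow_eq hαP hAQ
  have hS' : ∀ᶠ w : HeightOneSpectrum (𝓞 E) in cofinite,
      w.under (𝓞 F) ∉ (S : Set (HeightOneSpectrum (𝓞 F))) :=
    (tendsto_under_cofinite (𝓞 F)).eventually S.eventually_cofinite_notMem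
  have hS₁' : ∀ᶠ w : HeightOneSpectrum (𝓞 E) in cofinite, w ∉ (S₁ : Set _) :=
    S₁.eventually_cofinite_notMem
  filter_upwards [hrel, hS', hS₁', hρ] with w hw hwS hwS₁ hρw v' β hv' hβ
  have hv'' : w.under (𝓞 F) = v' := HeightOneSpectrum.ext hv'
  subst hv''
  -- `β = q_v^{s} αP(v)`: `q_v^{-s} β` and `αP v` are two `L²` Satake parameters of `P` at `v`
  have hβ' : β = (αP (w.under (𝓞 F))).map ((((w.under (𝓞 F)).residueCard : ℂ) ^ s) * ·) := by
    obtain ⟨𝔫, ϖ, h𝔫, hv𝔫, hSat⟩ := hpt _ β hβ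
    obtain ⟨𝔫', h𝔫', hv𝔫', ϖ', hϖ'⟩ := hαP _ hwS
    have heq := HasSatakeParameterAt.eq_of_ofLocal_eq_smul
      Flath1979_heckeOperatorAt_ofLocal_eq_smul_holds P h𝔫' h𝔫 hv𝔫' hv𝔫 hϖ' hSat
    rw [heq, Multiset.map_map]
    have hid : ((fun x : ℂ => ((w.under (𝓞 F)).residueCard : ℂ) ^ s * x) ∘
        fun x => ((w.under (𝓞 F)).residueCard : ℂ) ^ (-s) * x) = id :=
      funext fun a => residueCard_cpow_mul_cpow_neg_mul _ s a
    rw [hid, Multiset.map_id]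
  -- `t_{ρ,w} = AQ(w)` and `t_{Π,w} = q_w^{s} AQ(w) = q_w^{s} (αP v)^{f}`
  have hρw' : ρ.1.HasSatakeParamAt w (AQ w) := by
    obtain ⟨𝔫, h𝔫, hw𝔫, ϖ, hSat⟩ := hAQ _ hwS₁
    exact hρw 𝔫 ϖ (AQ w) h𝔫 hw𝔫 hSat
  have hPEw : PE.1.HasSatakeParamAt w ((AQ w).map (((w.residueCard : ℂ) ^ (-(-s))) * ·)) :=
    AutomorphicRepData.HasSatakeParamAt.of_map_mulChar_detTwist_of_cpow hχ hPEW hPEW' hρw'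
  rw [neg_neg, hw hwS hwS₁, Multiset.map_map] at hPEw
  rw [hβ', Multiset.map_map]
  have hfun : ((fun a : ℂ => a ^ w.asIdeal.inertiaDeg (𝓞 F)) ∘
      fun x : ℂ => ((w.under (𝓞 F)).residueCard : ℂ) ^ s * x) =
      ((fun x : ℂ => (w.residueCard : ℂ) ^ s * x) ∘ fun a : ℂ => a ^ w.asIdeal.inertiaDeg (𝓞 F)) := by
    funext a
    simp only [Function.comp_apply]
    rw [mul_pow, residueCard_cpow_eq_residueCard_under_cpow_pow (F := F) w s]
  rw [hfun]
  exact hPEw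

end Summit.Langlands.Langlands.Theorems.QuadraticBaseChangeGL2

end
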